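import Literature.Topology.FourManifolds.Collapsible
import Literature.Topology.FourManifolds.CollapsibleBallBase
import Literature.Topology.FourManifolds.RadialEngulfing
import Literature.Topology.FourManifolds.SimplexChart
import Literature.Topology.FourManifolds.ComplexTopSimplex
import Literature.Topology.FourManifolds.BoundaryGluingData
import HarnessLib

/-!
# Proof: smoothly collapsible sets have arbitrarily small smooth closed-ball neighbourhoods

Topic `Literature/Topology/FourManifolds`; discharges the named fact
`Literature.Topology.FourManifolds.exists_isSmoothEmbedding_closedBall_of_isSmoothlyCollapsible`
(`Collapsible.lean`): for a smoothly collapsible subset `s` (a collapsible finite subcomplex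
`K₀ ≤ K` of a smoothly, non-degenerately embedded finite complex `f : |K| → M` whose image is a
neighbourhood of `s = f(|K₀|)`) of a smooth `(n+1)`-manifold `M` and every open `U ⊇ s` there is a
smooth embedding `j : 𝔻ⁿ⁺¹ → M` of the closed unit ball with `j(𝔻ⁿ⁺¹) ⊆ U` and `s ⊆ j(B̊)`
(Hirsch 1962: smooth regular neighbourhoods of a subcomplex of a smooth triangulation exist in
any neighbourhood, are unique and are unchanged under collapsing, hence are discs for
collapsible complexes; Whitehead 1939 / Rourke–Sanderson 1972, Cor. 3.27).

## The proof formalised here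

The printed proofs go through PL regular-neighbourhood theory and the uniqueness of smooth
regular neighbourhoods.  The tree proves the statement directly by **induction on the collapse**
`K₀ ↘ K₁ ↘ ⋯ ↘ {v}` (`Literature.Topology.FourManifolds.FaceCollapses`, a reflexive–transitive
chain of elementary collapses), engulfing one simplex at a time by an ambient diffeomorphism —
the smooth analogue of "a regular neighbourhood of `Y` stretches over `X ↘ Y`" (Rourke–Sanderson
1972, Ch. 3; Rushing 1973, Ex. 1.6.12), which is also the mechanism behind Hirsch's invariance of
smooth regular neighbourhoods under collapsing:

* base (`CollapsibleBallBase.lean`): a vertex has small ball neighbourhoods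
  (`exists_isSmoothEmbedding_closedBall_of_mem_nhds`);
* step (`exists_ball_step`): if `σ` is a free face of `τ = σ ∪ {a}` in the down-closed family
  `F ⊆ K₀` and `j` is a ball inside `U` engulfing `f(|F ∖ {σ, τ}|)`, then some ball inside `U`
  engulfs `f(|F|)`.  By `ComplexTopSimplex.lean` the simplex `τ` is a face of a face `ρ` of `K` with
  `n + 2` vertices, so (`SimplexChart.lean`) there is a chart `Φ` of the maximal atlas of `M` in
  which `f(conv τ)` is a flat simplex `Δ` with apex `o` (the vertex over `a`) and
  `f(|F ∖ {σ, τ}|)` meets `Δ` inside the union `H` of the facets of `Δ` through `o` (freeness of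
  `σ` and the intersection axiom of `K`); the radial engulfing diffeomorphism `G` of
  `RadialEngulfing.lean` (`exists_diffeomorph_mapsTo_image_supset`: flow of a compactly supported
  field, Hirsch 1976, Ch. 8 §1) then satisfies `G(U) ⊆ U` and `f(|F|) ⊆ G(j(B̊))`, and `G ∘ j` is
  the new ball (`Manifold.IsSmoothEmbedding.diffeomorph_comp`);
* the induction (`exists_ball_of_faceCollapses`) and the discharge
  `exists_isSmoothEmbedding_closedBall_of_isSmoothlyCollapsible_holds`.

Everything here is proved; no definitions, no named facts.

## References

* M. W. Hirsch, *Smooth regular neighborhoods*, Ann. of Math. (2) 76 (1962) 524–530. [Hirsch1962]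
* C. P. Rourke, B. J. Sanderson, *Introduction to piecewise-linear topology* (1972), Ch. 3,
  Cor. 3.27. [RourkeSanderson1972]
* T. B. Rushing, *Topological embeddings* (1973), Exercise 1.6.12. [Rushing1973]
* M. W. Hirsch, *Differential Topology*, GTM 33 (1976), Ch. 8 §1. [HirschDT1976]
* J. R. Munkres, *Elementary differential topology* (rev. 1966), §8. [Munkres1966]
-/

open scoped Manifold ContDiff Topology
open Set Function

noncomputable section

namespace Literature.Topology.FourManifolds

universe u

/-! ### Enumerations and model vertices -/

/-- A finite set with `m` elements has an injective enumeration by `Fin m`. [folklore] -/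
theorem exists_injective_image_univ_eq {α : Type*} [DecidableEq α] (ρ : Finset α) {m : ℕ}
    (h : ρ.card = m) : ∃ v : Fin m → α, Injective v ∧ Finset.univ.image v = ρ := by
  set e : ρ ≃ Fin m := ρ.equivFin.trans (finCongr h) with he
  refine ⟨fun i => (e.symm i).1, fun i j hij => e.symm.injective (Subtype.ext hij), ?_⟩
  ext x
  simp only [Finset.mem_image, Finset.mem_univ, true_and]
  constructor
  · rintro ⟨i, rfl⟩
    exact (e.symm i).2
  · intro hx
    exact ⟨e ⟨x, hx⟩, by rw [e.symm_apply_apply]⟩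

section Model

variable {W : Type*} [NormedAddCommGroup W] [NormedSpace ℝ W] {k : ℕ}

/-- **Faces of the model simplex correspond to faces of the simplex**: for `S ⊆ {v₀, …, v_k}`
the affine chart `simplexAffine v` carries the hull of the model vertices over `S` onto `conv S`.
[folklore] -/
theorem image_simplexAffine_convexHull_filter [DecidableEq W] (v : Fin (k + 1) → W)
    {S : Finset W} (hS : S ⊆ Finset.univ.image v) :
    simplexAffine v '' convexHull ℝ
        (((Finset.univ.filter fun i => v i ∈ S).image (modelVertex k) : Finset _) : Set _) =
      convexHull ℝ (S : Set W) := by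
  rw [AffineMap.image_convexHull, Finset.coe_image, image_image]
  congr 1
  ext x
  simp only [Finset.coe_filter, Finset.mem_univ, true_and, mem_image, mem_setOf_eq,
    simplexAffine_modelVertex, Finset.mem_coe]
  constructor
  · rintro ⟨i, hi, rfl⟩
    exact hi
  · intro hx
    obtain ⟨i, -, rfl⟩ := Finset.mem_image.1 (hS hx)
    exact ⟨i, hx, rfl⟩

omit [NormedAddCommGroup W] [NormedSpace ℝ W] in
/-- The hull of a set of model vertices lies in the model simplex. [folklore] -/
theorem convexHull_filter_subset (v : Fin (k + 1) → W) (S : Finset W) [DecidablePred (· ∈ S)] :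
    convexHull ℝ (((Finset.univ.filter fun i => v i ∈ S).image (modelVertex k) : Finset _) :
        Set (EuclideanSpace ℝ (Fin k))) ⊆ convexHull ℝ (range (modelVertex k)) := by
  refine convexHull_mono ?_
  rw [Finset.coe_image]
  exact image_subset_range _ _

omit [NormedAddCommGroup W] [NormedSpace ℝ W] in
/-- A model vertex belongs to the model vertices over `S` iff the corresponding vertex is in `S`.
[folklore] -/
theorem modelVertex_mem_image_filter_iff (v : Fin (k + 1) → W) (S : Finset W)
    [DecidablePred (· ∈ S)] (i : Fin (k + 1)) :
    modelVertex k i ∈ (Finset.univ.filter fun i => v i ∈ S).image (modelVertex k) ↔ v i ∈ S := by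
  rw [Finset.mem_image]
  constructor
  · rintro ⟨i', hi', h⟩
    rw [(affineIndependent_modelVertex k).injective h] at hi'
    simpa using hi'
  · intro h
    exact ⟨i, by simpa using h, rfl⟩

/-- Pulling membership back along the injective affine chart: if `simplexAffine v y ∈ conv S`,
`S ⊆ {v₀, …, v_k}`, then `y` lies in the hull of the model vertices over `S`. [folklore] -/
theorem mem_convexHull_filter_of_simplexAffine_mem [DecidableEq W] {v : Fin (k + 1) → W}
    (hv : AffineIndependent ℝ v) {S : Finset W} (hS : S ⊆ Finset.univ.image v)
    {y : EuclideanSpace ℝ (Fin k)} (hy : simplexAffine v y ∈ convexHull ℝ (S : Set W)) :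
    y ∈ convexHull ℝ
      (((Finset.univ.filter fun i => v i ∈ S).image (modelVertex k) : Finset _) : Set _) := by
  rw [← image_simplexAffine_convexHull_filter v hS] at hy
  obtain ⟨y', hy', hyy⟩ := hy
  rwa [← injective_simplexAffine hv hyy]

end Model

/-! ### Combinatorics of a free face -/

section FreeFace

variable {ι : Type*} [DecidableEq ι] {F : Set (Finset ι)} {σ τ : Finset ι}

/-- For a free face `σ ⊂ τ` (with `card τ = card σ + 1`) there is a unique **apex** `a`:
`τ ∖ σ = {a}`. [folklore] -/
theorem IsFreeFace.exists_sdiff_eq_singleton (h : IsFreeFace F σ τ) :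
    ∃ a, a ∈ τ ∧ a ∉ σ ∧ τ \ σ = {a} := by
  have hcard : (τ \ σ).card = 1 := by
    rw [Finset.card_sdiff_of_subset h.ssubset.subset, h.card_eq]; omega
  obtain ⟨a, ha⟩ := Finset.card_eq_one.1 hcard
  have hmem : a ∈ τ \ σ := by rw [ha]; exact Finset.mem_singleton_self a
  exact ⟨a, (Finset.mem_sdiff.1 hmem).1, (Finset.mem_sdiff.1 hmem).2, ha⟩

/-- **The intersection pattern of a free pair.**  If `σ` is a free face of `τ` in `F`, `a` the
apex (`a ∈ τ ∖ σ`), and `s ∈ F ∖ {σ, τ}`, then `τ ∩ s` lies in a facet `τ ∖ {b}` of `τ` through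
`a` (`b ∈ σ`): otherwise `s` would contain `σ` or `τ`, contradicting freeness. [folklore] -/
theorem IsFreeFace.exists_inter_subset_erase (h : IsFreeFace F σ τ) {a : ι} (haτ : a ∈ τ)
    (haσ : a ∉ σ) {s : Finset ι} (hs : s ∈ F) (hsσ : s ≠ σ) (hsτ : s ≠ τ) :
    ∃ b ∈ σ, τ ∩ s ⊆ τ.erase b := by
  set I := τ ∩ s with hI
  have hIτ : I ⊆ τ := Finset.inter_subset_left
  -- `I ≠ τ`
  have hIne : I ≠ τ := by
    intro hIeq
    have hτs : τ ⊆ s := by rw [← hIeq]; exact Finset.inter_subset_right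
    rcases hτs.eq_or_ssubset with heq | hss
    · exact hsτ heq.symm
    · exact h.not_ssubset hs hss
  obtain ⟨c, hcτ, hcI⟩ := Finset.exists_of_ssubset (Finset.ssubset_iff_subset_ne.2 ⟨hIτ, hIne⟩)
  by_cases hcσ : c ∈ σ
  · exact ⟨c, hcσ, fun x hx => Finset.mem_erase.2 ⟨fun hxc => hcI (hxc ▸ hx), hIτ hx⟩⟩
  · -- `c` is the apex, so `I ⊆ σ`, and `I ≠ σ` by freeness
    have hca : c = a := by
      obtain ⟨a', -, -, ha'⟩ := h.exists_sdiff_eq_singleton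
      have h1 : c ∈ τ \ σ := Finset.mem_sdiff.2 ⟨hcτ, hcσ⟩
      have h2 : a ∈ τ \ σ := Finset.mem_sdiff.2 ⟨haτ, haσ⟩
      rw [ha', Finset.mem_singleton] at h1 h2
      rw [h1, h2]
    subst hca
    have hIσ : I ⊆ σ := by
      intro x hx
      by_contra hxσ
      obtain ⟨a', -, -, ha'⟩ := h.exists_sdiff_eq_singleton
      have h1 : x ∈ τ \ σ := Finset.mem_sdiff.2 ⟨hIτ hx, hxσ⟩
      have h2 : c ∈ τ \ σ := Finset.mem_sdiff.2 ⟨hcτ, hcσ⟩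
      rw [ha', Finset.mem_singleton] at h1 h2
      exact hcI (h1.trans h2.symm ▸ hx)
    have hIneσ : I ≠ σ := by
      intro hIeq
      have hσs : σ ⊆ s := by rw [← hIeq]; exact Finset.inter_subset_right
      rcases hσs.eq_or_ssubset with heq | hss
      · exact hsσ heq.symm
      · exact hsτ (h.eq_of_ssubset hs hss)
    obtain ⟨b, hbσ, hbI⟩ :=
      Finset.exists_of_ssubset (Finset.ssubset_iff_subset_ne.2 ⟨hIσ, hIneσ⟩)
    exact ⟨b, hbσ, fun x hx => Finset.mem_erase.2 ⟨fun hxb => hbI (hxb ▸ hx), hIτ hx⟩⟩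

/-- The facets of `τ` through the apex belong to `F ∖ {σ, τ}` (down-closure; they contain the
apex, so differ from `σ`, and miss `b`, so differ from `τ`). [folklore] -/
theorem IsFreeFace.erase_mem_diff (h : IsFreeFace F σ τ) (hF : IsRelLowerSet F Finset.Nonempty)
    {a : ι} (haτ : a ∈ τ) (haσ : a ∉ σ) {b : ι} (hb : b ∈ σ) :
    τ.erase b ∈ F \ {σ, τ} := by
  have hab : a ≠ b := fun hab => haσ (hab ▸ hb)
  have ha : a ∈ τ.erase b := Finset.mem_erase.2 ⟨hab, haτ⟩
  refine ⟨(hF h.snd_mem).2 (Finset.erase_subset b τ) ⟨a, ha⟩, ?_⟩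
  simp only [mem_insert_iff, mem_singleton_iff, not_or]
  refine ⟨fun heq => haσ (heq ▸ ha), fun heq => ?_⟩
  have := Finset.mem_erase.1 (heq.symm ▸ h.ssubset.subset hb : b ∈ τ.erase b)
  exact this.1 rfl

end FreeFace

/-! ### The engulfing step -/

section Step

variable {n N : ℕ} {M : Type u} [TopologicalSpace M] [T2Space M]
  [ChartedSpace (EuclideanSpace ℝ (Fin (n + 1))) M] [IsManifold (𝓡 (n + 1)) ∞ M]
  {K K₀ : Geometry.SimplicialComplex ℝ (EuclideanSpace ℝ (Fin N))}
  {f : EuclideanSpace ℝ (Fin N) → M}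

omit [T2Space M] in
/-- The image of the open unit ball under a smoothly embedded closed ball is open in `M`.
[folklore] -/
theorem isOpen_image_ball_of_isSmoothEmbedding
    {j : (Metric.closedBall (0 : EuclideanSpace ℝ (Fin (n + 1))) 1) → M}
    (hj : Manifold.IsSmoothEmbedding (𝓡∂ (n + 1)) (𝓡 (n + 1)) ∞ j) :
    IsOpen (j '' {x | ‖(x : EuclideanSpace ℝ (Fin (n + 1)))‖ < 1}) :=
  isOpen_image_of_isSmoothEmbedding_of_subset_interior hj
    (isOpen_lt (continuous_norm.comp continuous_subtype_val) continuous_const)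
    (by rw [interior_closedBall])

omit [T2Space M] [IsManifold (𝓡 (n + 1)) ∞ M] in
/-- The image of the union of the simplices of a finite family of faces is compact. [folklore] -/
theorem IsSmoothComplexEmbedding.isCompact_image_biUnion (hf : IsSmoothComplexEmbedding (n + 1) K f)
    {F : Set (Finset (EuclideanSpace ℝ (Fin N)))} (hF : F ⊆ K.faces) :
    IsCompact (f '' ⋃ t ∈ F, convexHull ℝ (t : Set (EuclideanSpace ℝ (Fin N)))) := by
  have hFfin : F.Finite := hf.1.subset hF
  refine (hFfin.isCompact_biUnion fun t _ => t.finite_toSet.isCompact_convexHull ℝ).image_of_continuousOn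
    (hf.continuousOn.mono ?_)
  exact iUnion₂_subset fun t ht => K.convexHull_subset_space (hF ht)

set_option maxHeartbeats 1600000 in
/-- **The engulfing step of the induction on the collapse.**  Let `f` be a smooth non-degenerate
embedding of the finite complex `K` into `M` with `f(|K₀|)` in the interior of `f(|K|)` for the
subcomplex `K₀ ≤ K`, `F ⊆ K₀.faces` a down-closed family, `σ` a free face of `τ` in `F`, `U` open
containing `f(|F|)`, and `j` a smoothly embedded closed ball inside `U` whose open ball contains
`f(|F ∖ {σ, τ}|)`.  Then there is a smoothly embedded closed ball inside `U` whose open ball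
contains `f(|F|)` (module docstring: chart flattening a top simplex `ρ ⊇ τ`, radial engulfing
along the cone from the apex over the facets through it, transport of `j` by the resulting
diffeomorphism).  Rourke–Sanderson (1972), Ch. 3 (regular neighbourhoods collapse / stretch);
Hirsch (1962). [cite: Hirsch1962, pp. 524–530] -/
theorem IsSmoothComplexEmbedding.exists_ball_step (hf : IsSmoothComplexEmbedding (n + 1) K f)
    (hle : K₀ ≤ K) (hint : f '' K₀.space ⊆ interior (f '' K.space))
    {F : Set (Finset (EuclideanSpace ℝ (Fin N)))} (hF : F ⊆ K₀.faces)
    (hFd : IsRelLowerSet F Finset.Nonempty) {σ τ : Finset (EuclideanSpace ℝ (Fin N))}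
    (hfree : IsFreeFace F σ τ) {U : Set M} (hU : IsOpen U)
    (hFU : f '' (⋃ t ∈ F, convexHull ℝ (t : Set (EuclideanSpace ℝ (Fin N)))) ⊆ U)
    {j : (Metric.closedBall (0 : EuclideanSpace ℝ (Fin (n + 1))) 1) → M}
    (hj : Manifold.IsSmoothEmbedding (𝓡∂ (n + 1)) (𝓡 (n + 1)) ∞ j) (hjU : range j ⊆ U)
    (hGj : f '' (⋃ t ∈ F \ {σ, τ}, convexHull ℝ (t : Set (EuclideanSpace ℝ (Fin N)))) ⊆
      j '' {x | ‖(x : EuclideanSpace ℝ (Fin (n + 1)))‖ < 1}) :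
    ∃ j' : (Metric.closedBall (0 : EuclideanSpace ℝ (Fin (n + 1))) 1) → M,
      Manifold.IsSmoothEmbedding (𝓡∂ (n + 1)) (𝓡 (n + 1)) ∞ j' ∧ range j' ⊆ U ∧
      f '' (⋃ t ∈ F, convexHull ℝ (t : Set (EuclideanSpace ℝ (Fin N)))) ⊆
        j' '' {x | ‖(x : EuclideanSpace ℝ (Fin (n + 1)))‖ < 1} := by
  classical
  -- notation
  set G : Set (Finset (EuclideanSpace ℝ (Fin N))) := F \ {σ, τ} with hG
  set O : Set M := j '' {x | ‖(x : EuclideanSpace ℝ (Fin (n + 1)))‖ < 1} with hO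
  have hOo : IsOpen O := isOpen_image_ball_of_isSmoothEmbedding hj
  set C : Set M := f '' (⋃ t ∈ G, convexHull ℝ (t : Set (EuclideanSpace ℝ (Fin N)))) with hC
  have hGF : G ⊆ F := sdiff_subset
  have hFK₀ : ∀ t ∈ F, t ∈ K₀.faces := fun t ht => hF ht
  have hFK : ∀ t ∈ F, t ∈ K.faces := fun t ht => hle (hF ht)
  have hCc : IsCompact C := hf.isCompact_image_biUnion fun t ht => hFK t (hGF ht)
  have hτF : τ ∈ F := hfree.snd_mem
  have hσF : σ ∈ F := hfree.fst_mem
  have hτK : τ ∈ K.faces := hFK τ hτF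
  -- the apex
  obtain ⟨a, haτ, haσ, -⟩ := hfree.exists_sdiff_eq_singleton
  -- Step 1: a top face `ρ ⊇ τ`
  have hτint : f '' convexHull ℝ (τ : Set (EuclideanSpace ℝ (Fin N))) ⊆ interior (f '' K.space) :=
    (image_mono (K₀.convexHull_subset_space (hFK₀ τ hτF))).trans hint
  obtain ⟨ρ, hρ, hτρ, hcard⟩ := hf.exists_face_card_eq_of_image_subset_interior hτK hτint
  obtain ⟨v, hv, hvρ⟩ := exists_injective_image_univ_eq ρ hcard
  have hρv : ρ = Finset.univ.image v := hvρ.symm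
  have hvai : AffineIndependent ℝ v := affineIndependent_of_image_mem_faces hv (hρv ▸ hρ)
  -- Step 2: the chart flattening `ρ`
  obtain ⟨Φ, hΦ, hΔρ, hΦsymm⟩ := hf.exists_chart_simplexAffine hv (hρv ▸ hρ)
  set A := simplexAffine v with hA
  -- model faces
  set TS : Finset (EuclideanSpace ℝ (Fin N)) → Finset (EuclideanSpace ℝ (Fin (n + 1))) :=
    fun S => (Finset.univ.filter fun i => v i ∈ S).image (modelVertex (n + 1)) with hTS
  have hTSsub : ∀ S, convexHull ℝ (TS S : Set (EuclideanSpace ℝ (Fin (n + 1)))) ⊆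
      convexHull ℝ (range (modelVertex (n + 1))) := fun S => convexHull_filter_subset v S
  have hTSimg : ∀ S, S ⊆ ρ → A '' convexHull ℝ (TS S : Set (EuclideanSpace ℝ (Fin (n + 1)))) =
      convexHull ℝ (S : Set (EuclideanSpace ℝ (Fin N))) := fun S hS =>
    image_simplexAffine_convexHull_filter v (hρv ▸ hS)
  have hΦTS : ∀ S, S ⊆ ρ → Φ.symm '' convexHull ℝ (TS S : Set (EuclideanSpace ℝ (Fin (n + 1)))) =
      f '' convexHull ℝ (S : Set (EuclideanSpace ℝ (Fin N))) := by
    intro S hS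
    rw [← hTSimg S hS, image_image]
    refine image_congr fun y hy => ?_
    exact hΦsymm y (hTSsub S hy)
  -- the apex vertex in the model
  obtain ⟨i₀, hi₀⟩ : ∃ i, v i = a := by
    have : a ∈ Finset.univ.image v := hρv ▸ hτρ haτ
    simpa using this
  set o : EuclideanSpace ℝ (Fin (n + 1)) := modelVertex (n + 1) i₀ with ho
  have hoTS : ∀ S, o ∈ TS S ↔ a ∈ S := fun S => by
    rw [← hi₀]
    exact modelVertex_mem_image_filter_iff v S i₀
  -- the flat simplex and the cone over the facets through the apex
  set Δ : Set (EuclideanSpace ℝ (Fin (n + 1))) := convexHull ℝ (TS τ : Set _) with hΔ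
  set H : Set (EuclideanSpace ℝ (Fin (n + 1))) :=
    ⋃ b ∈ σ, convexHull ℝ (TS (τ.erase b) : Set (EuclideanSpace ℝ (Fin (n + 1)))) with hH
  have hΔc : IsCompact Δ := (TS τ).finite_toSet.isCompact_convexHull ℝ
  have hoΔ : o ∈ Δ := subset_convexHull ℝ _ (Finset.mem_coe.2 ((hoTS τ).2 haτ))
  have hΔo : StarConvex ℝ o Δ := (convex_convexHull ℝ _).starConvex hoΔ
  have hΔt : Δ ⊆ Φ.target := (hTSsub τ).trans hΔρ
  have hHc : IsCompact H :=
    σ.isCompact_biUnion fun b _ => (TS (τ.erase b)).finite_toSet.isCompact_convexHull ℝ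
  have hoHb : ∀ b ∈ σ, o ∈ convexHull ℝ (TS (τ.erase b) : Set (EuclideanSpace ℝ (Fin (n + 1)))) :=
    fun b hb => subset_convexHull ℝ _ (Finset.mem_coe.2 ((hoTS _).2
      (Finset.mem_erase.2 ⟨fun hab => haσ (hab ▸ hb), haτ⟩)))
  have hHo : StarConvex ℝ o H :=
    starConvex_iUnion fun b => starConvex_iUnion fun hb => (convex_convexHull ℝ _).starConvex (hoHb b hb)
  have hσne : σ.Nonempty := (hFd hσF).1
  have hoH : o ∈ H := mem_iUnion₂.2 ⟨hσne.choose, hσne.choose_spec, hoHb _ hσne.choose_spec⟩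
  have hHΔρ : H ⊆ convexHull ℝ (range (modelVertex (n + 1))) :=
    iUnion₂_subset fun b _ => hTSsub _
  have hHt : H ⊆ Φ.target := hHΔρ.trans hΔρ
  -- Step 3: the hypotheses of the radial engulfing lemma
  have hK₀K : K₀.space ⊆ K.space := space_mono_of_le hle
  have hCΔ : ∀ y ∈ Δ, Φ.symm y ∈ C → y ∈ H := by
    intro y hy hyC
    have hyρ : y ∈ convexHull ℝ (range (modelVertex (n + 1))) := hTSsub τ hy
    have hAy : A y ∈ convexHull ℝ (τ : Set (EuclideanSpace ℝ (Fin N))) := by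
      rw [← hTSimg τ hτρ]; exact mem_image_of_mem A hy
    rw [hΦsymm y hyρ] at hyC
    obtain ⟨z, hz, hzy⟩ := hyC
    obtain ⟨s', hs'G, hzs'⟩ := mem_iUnion₂.1 hz
    have hs'F : s' ∈ F := hGF hs'G
    have hs'K : s' ∈ K.faces := hFK s' hs'F
    have hzeq : z = A y := hf.injOn_space (K.convexHull_subset_space hs'K hzs')
      (K.convexHull_subset_space hτK hAy) hzy
    have hmem : A y ∈ convexHull ℝ ((τ ∩ s' : Finset _) : Set (EuclideanSpace ℝ (Fin N))) := by
      rw [Finset.coe_inter, ← Geometry.SimplicialComplex.convexHull_inter_convexHull hτK hs'K]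
      exact ⟨hAy, hzeq ▸ hzs'⟩
    have hs'σ : s' ≠ σ := fun h => hs'G.2 (by simp [h])
    have hs'τ : s' ≠ τ := fun h => hs'G.2 (by simp [h])
    obtain ⟨b, hbσ, hIb⟩ := hfree.exists_inter_subset_erase haτ haσ hs'F hs'σ hs'τ
    have hmem' : A y ∈ convexHull ℝ ((τ.erase b : Finset _) : Set (EuclideanSpace ℝ (Fin N))) :=
      convexHull_mono (by exact_mod_cast hIb) hmem
    have hyb := mem_convexHull_filter_of_simplexAffine_mem hvai
      (hρv ▸ (Finset.erase_subset b τ).trans hτρ) hmem'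
    exact mem_iUnion₂.2 ⟨b, hbσ, hyb⟩
  have hCO : C ⊆ O := hGj
  have hHO : MapsTo Φ.symm H O := by
    intro y hy
    obtain ⟨b, hbσ, hyb⟩ := mem_iUnion₂.1 hy
    have hbG : τ.erase b ∈ G := hfree.erase_mem_diff hFd haτ haσ hbσ
    have h1 : Φ.symm y ∈ f '' convexHull ℝ ((τ.erase b : Finset _) : Set (EuclideanSpace ℝ (Fin N))) := by
      rw [← hΦTS _ ((Finset.erase_subset b τ).trans hτρ)]; exact mem_image_of_mem _ hyb
    exact hCO ((image_mono (subset_biUnion_of_mem (u := fun t : Finset (EuclideanSpace ℝ (Fin N)) =>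
      convexHull ℝ (t : Set (EuclideanSpace ℝ (Fin N)))) hbG)) h1)
  have hΔU : MapsTo Φ.symm Δ U := by
    intro y hy
    have h1 : Φ.symm y ∈ f '' convexHull ℝ (τ : Set (EuclideanSpace ℝ (Fin N))) := by
      rw [← hΦTS τ hτρ]; exact mem_image_of_mem _ hy
    exact hFU ((image_mono (subset_biUnion_of_mem (u := fun t : Finset (EuclideanSpace ℝ (Fin N)) =>
      convexHull ℝ (t : Set (EuclideanSpace ℝ (Fin N)))) hτF)) h1)
  -- Step 4: engulf
  obtain ⟨Gd, hGU, hCG, hΔG⟩ := exists_diffeomorph_mapsTo_image_supset hΦ hΔc hΔo hΔt hHc hHo hoH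
    hHt hCc.isClosed hCΔ hOo hCO hHO hU hΔU
  -- Step 5: the new ball
  obtain ⟨hj', hrange, himage⟩ := isSmoothEmbedding_diffeomorph_comp_closedBall hj Gd
  refine ⟨Gd ∘ j, hj', ?_, ?_⟩
  · rw [hrange]
    rintro _ ⟨z, hz, rfl⟩
    exact hGU (hjU hz)
  · rw [himage]
    rintro _ ⟨x, hx, rfl⟩
    obtain ⟨t, htF, hxt⟩ := mem_iUnion₂.1 hx
    by_cases htG : t ∈ G
    · exact hCG ⟨x, mem_iUnion₂.2 ⟨t, htG, hxt⟩, rfl⟩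
    · -- `t = σ` or `t = τ`: the point lies in `conv τ`
      have htστ : t = σ ∨ t = τ := by
        have : t ∈ ({σ, τ} : Set (Finset (EuclideanSpace ℝ (Fin N)))) := by
          by_contra h; exact htG ⟨htF, h⟩
        simpa using this
      have hxτ : x ∈ convexHull ℝ (τ : Set (EuclideanSpace ℝ (Fin N))) := by
        rcases htστ with rfl | rfl
        · exact convexHull_mono (by exact_mod_cast hfree.ssubset.subset) hxt
        · exact hxt
      have : f x ∈ Φ.symm '' Δ := by
        rw [hΦTS τ hτρ]; exact mem_image_of_mem f hxτ
      exact hΔG this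

end Step

/-! ### The induction on the collapse and the discharge -/

section Main

variable {n N : ℕ} {M : Type u} [TopologicalSpace M] [T2Space M]
  [ChartedSpace (EuclideanSpace ℝ (Fin (n + 1))) M] [IsManifold (𝓡 (n + 1)) ∞ M]
  {K K₀ : Geometry.SimplicialComplex ℝ (EuclideanSpace ℝ (Fin N))}
  {f : EuclideanSpace ℝ (Fin N) → M}

/-- **Balls along a collapse.**  If the down-closed family `F ⊆ K₀.faces` collapses to a vertex,
then `f(|F|)` has smoothly embedded closed-ball neighbourhoods inside any open `U ⊇ f(|F|)`
(induction on the chain of elementary collapses: base `exists_isSmoothEmbedding_closedBall_of_mem_nhds`,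
step `exists_ball_step`). [cite: Hirsch1962, pp. 524–530] -/
theorem IsSmoothComplexEmbedding.exists_ball_of_faceCollapses
    (hf : IsSmoothComplexEmbedding (n + 1) K f) (hle : K₀ ≤ K)
    (hint : f '' K₀.space ⊆ interior (f '' K.space)) {v : EuclideanSpace ℝ (Fin N)}
    {F : Set (Finset (EuclideanSpace ℝ (Fin N)))}
    (hcoll : FaceCollapses F {({v} : Finset (EuclideanSpace ℝ (Fin N)))}) (hF : F ⊆ K₀.faces)
    (hFd : IsRelLowerSet F Finset.Nonempty) {U : Set M} (hU : IsOpen U)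
    (hFU : f '' (⋃ t ∈ F, convexHull ℝ (t : Set (EuclideanSpace ℝ (Fin N)))) ⊆ U) :
    ∃ j : (Metric.closedBall (0 : EuclideanSpace ℝ (Fin (n + 1))) 1) → M,
      Manifold.IsSmoothEmbedding (𝓡∂ (n + 1)) (𝓡 (n + 1)) ∞ j ∧ range j ⊆ U ∧
      f '' (⋃ t ∈ F, convexHull ℝ (t : Set (EuclideanSpace ℝ (Fin N)))) ⊆
        j '' {x | ‖(x : EuclideanSpace ℝ (Fin (n + 1)))‖ < 1} := by
  have hc : Relation.ReflTransGen IsElementaryCollapse F {({v} : Finset (EuclideanSpace ℝ (Fin N)))} :=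
    hcoll
  induction hc using Relation.ReflTransGen.head_induction_on generalizing U with
  | refl =>
    -- the family `{{v}}`: a point
    have hsp : (⋃ t ∈ ({({v} : Finset (EuclideanSpace ℝ (Fin N)))} : Set (Finset _)),
        convexHull ℝ (t : Set (EuclideanSpace ℝ (Fin N)))) = {v} := by
      rw [biUnion_singleton, Finset.coe_singleton, convexHull_singleton]
    rw [hsp, image_singleton, singleton_subset_iff] at hFU
    obtain ⟨j, hj, hjU, hvj⟩ :=
      exists_isSmoothEmbedding_closedBall_of_mem_nhds (n := n) (hU.mem_nhds hFU)
    refine ⟨j, hj, hjU, ?_⟩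
    rw [hsp, image_singleton, singleton_subset_iff]
    exact hvj
  | @head Fa Fc hFG hrest ih =>
    obtain ⟨σ, τ, hfree, rfl⟩ := hFG
    have hGF : Fa \ {σ, τ} ⊆ Fa := sdiff_subset
    have hGU : f '' (⋃ t ∈ Fa \ {σ, τ}, convexHull ℝ (t : Set (EuclideanSpace ℝ (Fin N)))) ⊆ U :=
      (image_mono (biUnion_subset_biUnion_left hGF)).trans hFU
    obtain ⟨j, hj, hjU, hGj⟩ := ih hrest (hGF.trans hF) (hfree.isRelLowerSet_diff hFd) hU hGU
    exact hf.exists_ball_step hle hint hF hFd hfree hU hFU hj hjU hGj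

variable (n) in
/-- **Smooth regular neighbourhoods of collapsible complexes are balls** — discharge of the named
fact `exists_isSmoothEmbedding_closedBall_of_isSmoothlyCollapsible` (`Collapsible.lean`): a
smoothly collapsible subset of a smooth `(n+1)`-manifold has, inside every open set containing
it, a neighbourhood which is a smoothly embedded closed `(n+1)`-ball.  Hirsch (1962): existence
of smooth regular neighbourhoods in any neighbourhood, uniqueness, invariance under `K ↘ L`,
hence discs for collapsible `K`; here by induction on the collapse with flow engulfing
(module docstring). [cite: Hirsch1962, pp. 524–530 (existence; uniqueness; invariance under collapsing K ↘ L)] -/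
theorem exists_isSmoothEmbedding_closedBall_of_isSmoothlyCollapsible_holds :
    exists_isSmoothEmbedding_closedBall_of_isSmoothlyCollapsible n := by
  intro M _ _ _ _ _ s U hs hU hsU
  obtain ⟨N, K, K₀, f, hf, hle, hK₀, rfl, hint⟩ := hs
  obtain ⟨v, hv⟩ := hK₀
  have hsp : K₀.space = ⋃ t ∈ K₀.faces, convexHull ℝ (t : Set (EuclideanSpace ℝ (Fin N))) := rfl
  rw [hsp] at hsU ⊢
  exact hf.exists_ball_of_faceCollapses hle hint hv Subset.rfl K₀.isRelLowerSet_faces hU hsU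

end Main

end Literature.Topology.FourManifolds
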